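import Mathlib
import Summits.ResolutionOfSingularities.ResolutionOfSingularities.Theorems.HomologicalConductorPersistenceKnorrerTransfer
import Summits.ResolutionOfSingularities.ResolutionOfSingularities.Theorems.HomologicalConductorPersistenceArenaIdealFormula
import Summits.ResolutionOfSingularities.ResolutionOfSingularities.Theorems.HomologicalConductorPersistenceArenaFloorCharFree
import HarnessLib

/-!
# Rung S-2 `PersistenceSurface` (stmt-ResolutionOfSingularities-19970) — the `A_r` TABLE IN EVERY CHARACTERISTIC:
# `ca(k[x,y,z]/(xy − zᵐ)) = ca³ = (x̄, ȳ, z̄^⌊m/2⌋)` over EVERY field (ceiling by the Knörrer certificate transfer)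

Route `ResolutionOfSingularities/HomologicalConductor`, chain W4.4b (cell res-hironaka; seat res-L1-w44b-stub-1
gen 6, lead-1 WAVE-3 row «arena cells (C2 kernel side)»). `[OURS · L1 w44b]` replaces the role of no printed item;
NOT a statement of the manuscript under review (Hironaka 2017), nothing here is attributed to its author; folklore
commutative algebra, AI-written (weaker than expert review).

## What and why

This seat's `…ArenaIdealFormula` (p562342/p563121) proved `ca(k[x,y,z]/(xy − zᵐ)) = ca³ = (x̄, ȳ, z̄^⌊m/2⌋)` — the
`A_{m−1}` arrivals of the S-2 ledger — under `2 ≠ 0`, a hypothesis borne by the two branched-cover descents of the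
arena sandwich (res-L1-w44b-tri-2 TRIAGE v18 R68: «p = 2 `A_r` arrivals not covered»).  Here both halves are
characteristic-free:

* FLOOR `(x̄, ȳ, z̄^⌊m/2⌋) ⊆ ca³` — `…ArenaFloorCharFree.span_le_cohomologyAnnihilatorOfDegree_three_arena'`
  (codimension-two quotient ascent, this seat);
* CEILING `caᴺ ⊆ (x̄, ȳ, z̄^⌊m/2⌋)` for every `N` (this file) — by res-type-010's KNÖRRER CERTIFICATE TRANSFER
  (`KnorrerTransfer.not_mem_cohomologyAnnihilatorOfDegree_knorrer`, p5xxxxx; characteristic-free polynomial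
  identities + res-D-pv-026's LOST criterion): along the retraction `π : x, y ↦ 0` of `ι : k[z] → k[x,y,z]`, the
  `1 × 1` factorisation `zⁱ · zᵐ⁻ⁱ = zᵐ` (`i = ⌊m/2⌋`) admits a certificate `c = G₀ zᵐ⁻ⁱ + zⁱ E₀` for `c ∈ k[z]` only
  if `zⁱ ∣ c`; so `(ι c)‾ ∈ caᴺ(T)` forces `c ∈ (zⁱ)`, and every `g ∈ k[x,y,z]` is `≡ ι(π g) (mod (x, y))` with
  `x̄, ȳ ∈ ca³(T)` (Jacobian elements).

Results (`T = k[x,y,z]/(xy − zᵐ)`, any field `k`, any `m`):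
* `mem_span_X_pow_of_certificate` — a `1 × 1` certificate over `(zⁱ, zᵐ⁻ⁱ)`, `i ≤ m − i`, forces `c ∈ (zⁱ)`;
* `proj_mem_span_of_mk_inclusion_mem` — `(ι c)‾ ∈ caᴺ(T)` ⇒ `c ∈ (z^⌊m/2⌋)`;
* **`cohomologyAnnihilatorOfDegree_arena_X_pow_le'`** — `caᴺ(T) ≤ (x̄, ȳ, z̄^⌊m/2⌋)` for every `N`;
* **`cohomologyAnnihilator_arena_X_pow_eq'`**, **`cohomologyAnnihilatorOfDegree_three_arena_X_pow_eq'`** —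
  `ca(T) = ca³(T) = (x̄, ȳ, z̄^⌊m/2⌋)` over EVERY field: the `A_r` table `ca(A_r) = (x, y, z^⌈r/2⌉)` (`m = r + 1`)
  of the S-2 ledger with no characteristic hypothesis.

References (mechanism only): H. Knörrer, *Cohen–Macaulay modules on hypersurface singularities I*, Invent. Math.
88 (1987) [`Knorrer1987`]; S. B. Iyengar, R. Takahashi, IMRN 2016, arXiv:1404.1476, §2 [`IyengarTakahashi2014`].
-/

noncomputable section

-- single-problem summit: the doubled namespace component `ResolutionOfSingularities` is forced
set_option linter.dupNamespace false

namespace Summit.ResolutionOfSingularities.ResolutionOfSingularities.Theorems.HomologicalConductor.ArenaCeilingCharFree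

open MvPolynomial Literature.RingTheory.CohomologyAnnihilator
open Summit.ResolutionOfSingularities.ResolutionOfSingularities.Theorems.HomologicalConductor
open scoped nonZeroDivisors

universe u

variable (k : Type u) [Field k] (m : ℕ)

/-! ## §1 One-by-one certificates over `(zⁱ, zᵐ⁻ⁱ)` -/

/-- A `1 × 1` certificate `c·1 = G₀ [zᵐ⁻ⁱ] + [zⁱ] E₀` with `i ≤ m − i` forces `c ∈ (zⁱ)`. [folklore] -/
theorem mem_span_X_pow_of_certificate {i : ℕ} (hi : i ≤ m - i) (c : MvPolynomial (Fin 1) k)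
    (hcert : ∃ G₀ E₀ : Matrix (Fin 1) (Fin 1) (MvPolynomial (Fin 1) k),
      c • (1 : Matrix (Fin 1) (Fin 1) (MvPolynomial (Fin 1) k)) =
        G₀ * !![(X 0 : MvPolynomial (Fin 1) k) ^ (m - i)] + !![(X 0 : MvPolynomial (Fin 1) k) ^ i] * E₀) :
    c ∈ Ideal.span {(X 0 : MvPolynomial (Fin 1) k) ^ i} := by
  obtain ⟨G₀, E₀, h⟩ := hcert
  have h00 := congrFun (congrFun h 0) 0
  simp only [Matrix.smul_apply, Matrix.one_apply_eq, smul_eq_mul, mul_one, Matrix.add_apply, Matrix.mul_apply,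
    Fin.sum_univ_one, Matrix.of_apply, Matrix.cons_val', Matrix.cons_val_fin_one, Matrix.empty_val'] at h00
  rw [h00]
  refine Ideal.add_mem _ ?_ (Ideal.mul_mem_right _ _ (Ideal.mem_span_singleton_self _))
  obtain ⟨d, hd⟩ : ∃ d, m - i = i + d := ⟨m - i - i, by omega⟩
  rw [hd, pow_add, ← mul_assoc, mul_comm (G₀ 0 0)]
  exact Ideal.mul_mem_right _ _ (Ideal.mul_mem_right _ _ (Ideal.mem_span_singleton_self _))

/-- `[zⁱ] · [zᵐ⁻ⁱ] = zᵐ · 1` (`i ≤ m`), both orders. [folklore] -/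
theorem pow_mf_mul {i : ℕ} (hi : i ≤ m) :
    !![(X 0 : MvPolynomial (Fin 1) k) ^ i] * !![(X 0 : MvPolynomial (Fin 1) k) ^ (m - i)] =
        ((X 0 : MvPolynomial (Fin 1) k) ^ m) • (1 : Matrix (Fin 1) (Fin 1) (MvPolynomial (Fin 1) k)) ∧
      !![(X 0 : MvPolynomial (Fin 1) k) ^ (m - i)] * !![(X 0 : MvPolynomial (Fin 1) k) ^ i] =
        ((X 0 : MvPolynomial (Fin 1) k) ^ m) • (1 : Matrix (Fin 1) (Fin 1) (MvPolynomial (Fin 1) k)) := by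
  have hpow : (X 0 : MvPolynomial (Fin 1) k) ^ i * X 0 ^ (m - i) = X 0 ^ m := by
    rw [← pow_add, Nat.add_sub_cancel' hi]
  constructor
  · ext a b
    fin_cases a; fin_cases b
    simp [Matrix.mul_apply, hpow]
  · ext a b
    fin_cases a; fin_cases b
    simp [Matrix.mul_apply, mul_comm, hpow]

/-! ## §2 `(ι c)‾ ∈ caᴺ(T)` forces `z^⌊m/2⌋ ∣ c` -/

/-- **Knörrer transfer at `xy = zᵐ`.** If `(ι c)‾ ∈ caᴺ(k[x,y,z]/(xy − zᵐ))` for `c ∈ k[z]`, then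
`c ∈ (z^⌊m/2⌋)`: otherwise `c` has no certificate over the factorisation `z^⌊m/2⌋ · z^{m − ⌊m/2⌋}` of `zᵐ`, and
`KnorrerTransfer.not_mem_cohomologyAnnihilatorOfDegree_knorrer` (retraction `x, y ↦ 0`) excludes `(ι c)‾` from
every `caᴺ`. [cite: Knorrer1987, §2] -/
theorem proj_mem_span_of_mk_inclusion_mem (c : MvPolynomial (Fin 1) k) (N : ℕ)
    (hc : Ideal.Quotient.mk (Ideal.span ({X 0 * X 1 -
        (MvPolynomial.aeval fun j : Fin (0 + 1) => (X j.succ.succ : MvPolynomial (Fin (0 + 3)) k))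
          ((X 0 : MvPolynomial (Fin 1) k) ^ m)} : Set (MvPolynomial (Fin (0 + 3)) k)))
        ((MvPolynomial.aeval fun j : Fin (0 + 1) => (X j.succ.succ : MvPolynomial (Fin (0 + 3)) k)) c) ∈
      cohomologyAnnihilatorOfDegree (MvPolynomial (Fin (0 + 3)) k ⧸ Ideal.span ({X 0 * X 1 -
        (MvPolynomial.aeval fun j : Fin (0 + 1) => (X j.succ.succ : MvPolynomial (Fin (0 + 3)) k))
          ((X 0 : MvPolynomial (Fin 1) k) ^ m)} : Set (MvPolynomial (Fin (0 + 3)) k))) N) :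
    c ∈ Ideal.span {(X 0 : MvPolynomial (Fin 1) k) ^ (m / 2)} := by
  letI : Algebra (MvPolynomial (Fin 1) k) (MvPolynomial (Fin (0 + 3)) k) :=
    ((MvPolynomial.aeval fun j : Fin (0 + 1) => (X j.succ.succ : MvPolynomial (Fin (0 + 3)) k)) :
      MvPolynomial (Fin 1) k →ₐ[k] MvPolynomial (Fin (0 + 3)) k).toRingHom.toAlgebra
  have halg : algebraMap (MvPolynomial (Fin 1) k) (MvPolynomial (Fin (0 + 3)) k) =
      ((MvPolynomial.aeval fun j : Fin (0 + 1) => (X j.succ.succ : MvPolynomial (Fin (0 + 3)) k)) :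
        MvPolynomial (Fin 1) k →ₐ[k] MvPolynomial (Fin (0 + 3)) k).toRingHom := rfl
  by_contra hnot
  have hi : m / 2 ≤ m - m / 2 := by omega
  obtain ⟨hφψ, hψφ⟩ := pow_mf_mul k m (i := m / 2) (by omega)
  have hno : ¬ ∃ G₀ E₀ : Matrix (Fin 1) (Fin 1) (MvPolynomial (Fin 1) k),
      c • (1 : Matrix (Fin 1) (Fin 1) (MvPolynomial (Fin 1) k)) =
        G₀ * !![(X 0 : MvPolynomial (Fin 1) k) ^ (m - m / 2)] + !![(X 0 : MvPolynomial (Fin 1) k) ^ (m / 2)] * E₀ :=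
    fun h => hnot (mem_span_X_pow_of_certificate k m hi c h)
  have hπ : ∀ s : MvPolynomial (Fin 1) k,
      (MvPolynomial.aeval (Fin.cons 0 (Fin.cons 0 fun j : Fin (0 + 1) => (X j : MvPolynomial (Fin (0 + 1)) k)) :
          Fin (0 + 3) → MvPolynomial (Fin (0 + 1)) k)).toRingHom
        (algebraMap (MvPolynomial (Fin 1) k) (MvPolynomial (Fin (0 + 3)) k) s) = s := fun s => by
    rw [halg, AlgHom.toRingHom_eq_coe, RingHom.coe_coe, AlgHom.toRingHom_eq_coe, RingHom.coe_coe]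
    exact ArenaSandwich.aeval_proj_inclusion k 0 s
  have hx : (MvPolynomial.aeval (Fin.cons 0 (Fin.cons 0 fun j : Fin (0 + 1) => (X j : MvPolynomial (Fin (0 + 1)) k)) :
      Fin (0 + 3) → MvPolynomial (Fin (0 + 1)) k)).toRingHom (X 0 : MvPolynomial (Fin (0 + 3)) k) = 0 := by
    rw [AlgHom.toRingHom_eq_coe, RingHom.coe_coe, MvPolynomial.aeval_X, Fin.cons_zero]
  have hy : (MvPolynomial.aeval (Fin.cons 0 (Fin.cons 0 fun j : Fin (0 + 1) => (X j : MvPolynomial (Fin (0 + 1)) k)) :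
      Fin (0 + 3) → MvPolynomial (Fin (0 + 1)) k)).toRingHom (X 1 : MvPolynomial (Fin (0 + 3)) k) = 0 := by
    rw [AlgHom.toRingHom_eq_coe, RingHom.coe_coe, MvPolynomial.aeval_X, show (1 : Fin (0 + 3)) = Fin.succ 0 from rfl,
      Fin.cons_succ, Fin.cons_zero]
  have hf : (X 0 * X 1 - algebraMap (MvPolynomial (Fin 1) k) (MvPolynomial (Fin (0 + 3)) k)
      ((X 0 : MvPolynomial (Fin 1) k) ^ m)) ∈ (MvPolynomial (Fin (0 + 3)) k)⁰ := by
    rw [halg, AlgHom.toRingHom_eq_coe, RingHom.coe_coe]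
    exact mem_nonZeroDivisors_of_ne_zero (ArenaGeneral.f_ne_zero k 0 _)
  have h := KnorrerTransfer.not_mem_cohomologyAnnihilatorOfDegree_knorrer
    (MvPolynomial.aeval (Fin.cons 0 (Fin.cons 0 fun j : Fin (0 + 1) => (X j : MvPolynomial (Fin (0 + 1)) k)) :
      Fin (0 + 3) → MvPolynomial (Fin (0 + 1)) k)).toRingHom hπ _ _ _ hφψ hψφ (X 0) (X 1) hx hy hf c hno N
  rw [halg, AlgHom.toRingHom_eq_coe, RingHom.coe_coe] at h
  exact h hc

/-! ## §3 The ceiling and the exact formula over every field -/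

/-- **CEILING, every field**: `caᴺ(k[x,y,z]/(xy − zᵐ)) ≤ (x̄, ȳ, z̄^⌊m/2⌋)` for every `N`.  For `t = ḡ ∈ caᴺ`:
`g ≡ ι(π g) (mod (x, y))` (`PersistenceArenaIdealFormula.sub_inclusion_proj_mem_span`) with `x̄, ȳ ∈ ca³` (Jacobian), so
`(ι(π g))‾ ∈ caᴺ⁺³`, whence `z^⌊m/2⌋ ∣ π g` by §2. [cite: Knorrer1987, §2] -/
theorem cohomologyAnnihilatorOfDegree_arena_X_pow_le' (N : ℕ) :
    cohomologyAnnihilatorOfDegree (MvPolynomial (Fin 3) k ⧸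
        Ideal.span {(MvPolynomial.X 0 * MvPolynomial.X 1 - MvPolynomial.X 2 ^ m : MvPolynomial (Fin 3) k)}) N ≤
      (Ideal.span ({MvPolynomial.X 0, MvPolynomial.X 1, MvPolynomial.X 2 ^ (m / 2)} : Set (MvPolynomial (Fin 3) k))).map
        (Ideal.Quotient.mk (Ideal.span {(MvPolynomial.X 0 * MvPolynomial.X 1 - MvPolynomial.X 2 ^ m :
          MvPolynomial (Fin 3) k)})) := by
  -- rewrite the equation as the arena `xy − ι(zᵐ)` with `n = 0`
  have hf : (MvPolynomial.X 0 * MvPolynomial.X 1 - MvPolynomial.X 2 ^ m : MvPolynomial (Fin 3) k) =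
      MvPolynomial.X 0 * MvPolynomial.X 1 - (MvPolynomial.aeval fun j : Fin (0 + 1) =>
        (MvPolynomial.X j.succ.succ : MvPolynomial (Fin (0 + 3)) k)) ((MvPolynomial.X 0 : MvPolynomial (Fin 1) k) ^ m) := by
    rw [PersistenceArArrivalFloor.aeval_inclusion_X_pow]
  intro t ht
  obtain ⟨g, rfl⟩ := Ideal.Quotient.mk_surjective t
  -- `c = π g`, `g − ι c ∈ (x, y)`
  have hsub := PersistenceArenaIdealFormula.sub_inclusion_proj_mem_span k 0 g
  have hxy : (Ideal.span ({MvPolynomial.X 0, MvPolynomial.X 1} : Set (MvPolynomial (Fin (0 + 3)) k))).map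
      (Ideal.Quotient.mk (Ideal.span {(MvPolynomial.X 0 * MvPolynomial.X 1 - MvPolynomial.X 2 ^ m :
        MvPolynomial (Fin 3) k)})) ≤
      cohomologyAnnihilatorOfDegree (MvPolynomial (Fin 3) k ⧸
        Ideal.span {(MvPolynomial.X 0 * MvPolynomial.X 1 - MvPolynomial.X 2 ^ m : MvPolynomial (Fin 3) k)}) (N + 3) := by
    rw [Ideal.map_span, Ideal.span_le]
    rintro _ ⟨q, hq, rfl⟩
    simp only [Set.mem_insert_iff, Set.mem_singleton_iff] at hq
    rcases hq with rfl | rfl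
    · have h0 := ArenaGeneral.mk_X0_mem_cohomologyAnnihilatorOfDegree k 0 ((MvPolynomial.X 0 : MvPolynomial (Fin 1) k) ^ m)
      rw [← hf] at h0
      exact cohomologyAnnihilatorOfDegree_mono (by omega) h0
    · have h0 := ArenaGeneral.mk_X1_mem_cohomologyAnnihilatorOfDegree k 0 ((MvPolynomial.X 0 : MvPolynomial (Fin 1) k) ^ m)
      rw [← hf] at h0
      exact cohomologyAnnihilatorOfDegree_mono (by omega) h0
  -- hence `(ι c)‾ ∈ caᴺ⁺³`
  have hιc : Ideal.Quotient.mk (Ideal.span {(MvPolynomial.X 0 * MvPolynomial.X 1 - MvPolynomial.X 2 ^ m :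
      MvPolynomial (Fin 3) k)}) ((MvPolynomial.aeval fun j : Fin (0 + 1) =>
        (MvPolynomial.X j.succ.succ : MvPolynomial (Fin (0 + 3)) k))
        ((MvPolynomial.aeval (Fin.cons 0 (Fin.cons 0 fun j : Fin (0 + 1) =>
          (MvPolynomial.X j : MvPolynomial (Fin (0 + 1)) k)) : Fin (0 + 3) → MvPolynomial (Fin (0 + 1)) k)) g)) ∈
      cohomologyAnnihilatorOfDegree (MvPolynomial (Fin 3) k ⧸
        Ideal.span {(MvPolynomial.X 0 * MvPolynomial.X 1 - MvPolynomial.X 2 ^ m : MvPolynomial (Fin 3) k)}) (N + 3) := by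
    have h1 : Ideal.Quotient.mk (Ideal.span {(MvPolynomial.X 0 * MvPolynomial.X 1 - MvPolynomial.X 2 ^ m :
        MvPolynomial (Fin 3) k)}) (g - (MvPolynomial.aeval fun j : Fin (0 + 1) =>
          (MvPolynomial.X j.succ.succ : MvPolynomial (Fin (0 + 3)) k))
          ((MvPolynomial.aeval (Fin.cons 0 (Fin.cons 0 fun j : Fin (0 + 1) =>
            (MvPolynomial.X j : MvPolynomial (Fin (0 + 1)) k)) : Fin (0 + 3) → MvPolynomial (Fin (0 + 1)) k)) g)) ∈
        cohomologyAnnihilatorOfDegree (MvPolynomial (Fin 3) k ⧸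
          Ideal.span {(MvPolynomial.X 0 * MvPolynomial.X 1 - MvPolynomial.X 2 ^ m : MvPolynomial (Fin 3) k)}) (N + 3) :=
      hxy (Ideal.mem_map_of_mem _ hsub)
    rw [map_sub] at h1
    have h2 := Ideal.sub_mem _ (cohomologyAnnihilatorOfDegree_mono (show N ≤ N + 3 by omega) ht) h1
    rwa [sub_sub_cancel] at h2
  -- §2 (after rewriting the defining equation): `z^⌊m/2⌋ ∣ π g`
  have hI : Ideal.span {(MvPolynomial.X 0 * MvPolynomial.X 1 - MvPolynomial.X 2 ^ m : MvPolynomial (Fin 3) k)} =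
      Ideal.span ({X 0 * X 1 - (MvPolynomial.aeval fun j : Fin (0 + 1) => (X j.succ.succ : MvPolynomial (Fin (0 + 3)) k))
        ((X 0 : MvPolynomial (Fin 1) k) ^ m)} : Set (MvPolynomial (Fin (0 + 3)) k)) := by
    rw [hf]
  have hιc' := ringEquiv_apply_mem_cohomologyAnnihilatorOfDegree (Ideal.quotEquivOfEq hI) hιc
  rw [Ideal.quotEquivOfEq_mk] at hιc'
  have hc := proj_mem_span_of_mk_inclusion_mem k m _ (N + 3) hιc'
  -- assemble: `g = (g − ι c) + ι c ∈ (x, y) + (z^⌊m/2⌋)`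
  have hιc_mem : (MvPolynomial.aeval fun j : Fin (0 + 1) => (MvPolynomial.X j.succ.succ : MvPolynomial (Fin (0 + 3)) k))
      ((MvPolynomial.aeval (Fin.cons 0 (Fin.cons 0 fun j : Fin (0 + 1) =>
        (MvPolynomial.X j : MvPolynomial (Fin (0 + 1)) k)) : Fin (0 + 3) → MvPolynomial (Fin (0 + 1)) k)) g) ∈
      Ideal.span ({MvPolynomial.X 0, MvPolynomial.X 1, MvPolynomial.X 2 ^ (m / 2)} : Set (MvPolynomial (Fin 3) k)) := by
    obtain ⟨d, hd⟩ := Ideal.mem_span_singleton'.mp hc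
    rw [← hd, map_mul, PersistenceArArrivalFloor.aeval_inclusion_X_pow]
    exact Ideal.mul_mem_left _ _ (Ideal.subset_span (by simp))
  have hg : g ∈ Ideal.span ({MvPolynomial.X 0, MvPolynomial.X 1, MvPolynomial.X 2 ^ (m / 2)} :
      Set (MvPolynomial (Fin 3) k)) := by
    have hle : Ideal.span ({MvPolynomial.X 0, MvPolynomial.X 1} : Set (MvPolynomial (Fin (0 + 3)) k)) ≤
        Ideal.span ({MvPolynomial.X 0, MvPolynomial.X 1, MvPolynomial.X 2 ^ (m / 2)} : Set (MvPolynomial (Fin 3) k)) :=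
      Ideal.span_mono (fun q hq => by
        simp only [Set.mem_insert_iff, Set.mem_singleton_iff] at hq ⊢
        rcases hq with rfl | rfl
        · exact Or.inl rfl
        · exact Or.inr (Or.inl rfl))
    have h := Ideal.add_mem _ (hle hsub) hιc_mem
    rwa [sub_add_cancel] at h
  exact Ideal.mem_map_of_mem _ hg

/-- **`ca(k[x,y,z]/(xy − zᵐ)) = (x̄, ȳ, z̄^⌊m/2⌋)` over EVERY field** (floor: `…ArenaFloorCharFree`; ceiling:
`cohomologyAnnihilatorOfDegree_arena_X_pow_le'`).  With `m = r + 1`: `ca(A_r) = (x, y, z^⌈r/2⌉)` in every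
characteristic. [cite: IyengarTakahashi2014, Definition 2.1] -/
theorem cohomologyAnnihilator_arena_X_pow_eq' :
    cohomologyAnnihilator (MvPolynomial (Fin 3) k ⧸
        Ideal.span {(MvPolynomial.X 0 * MvPolynomial.X 1 - MvPolynomial.X 2 ^ m : MvPolynomial (Fin 3) k)}) =
      (Ideal.span ({MvPolynomial.X 0, MvPolynomial.X 1, MvPolynomial.X 2 ^ (m / 2)} : Set (MvPolynomial (Fin 3) k))).map
        (Ideal.Quotient.mk (Ideal.span {(MvPolynomial.X 0 * MvPolynomial.X 1 - MvPolynomial.X 2 ^ m :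
          MvPolynomial (Fin 3) k)})) := by
  apply le_antisymm
  · intro t ht
    obtain ⟨N, hN⟩ := mem_cohomologyAnnihilator_iff.mp ht
    exact cohomologyAnnihilatorOfDegree_arena_X_pow_le' k m N hN
  · exact (ArenaFloorCharFree.span_le_cohomologyAnnihilatorOfDegree_three_arena' k m).trans
      (cohomologyAnnihilatorOfDegree_le 3)

/-- **`ca³(k[x,y,z]/(xy − zᵐ)) = (x̄, ȳ, z̄^⌊m/2⌋) = ca(k[x,y,z]/(xy − zᵐ))` over EVERY field** — saturation of the
`A_r` surface at level `3`, characteristic `2` included. [cite: IyengarTakahashi2014, Definition 2.1] -/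
theorem cohomologyAnnihilatorOfDegree_three_arena_X_pow_eq' :
    cohomologyAnnihilatorOfDegree (MvPolynomial (Fin 3) k ⧸
        Ideal.span {(MvPolynomial.X 0 * MvPolynomial.X 1 - MvPolynomial.X 2 ^ m : MvPolynomial (Fin 3) k)}) 3 =
      (Ideal.span ({MvPolynomial.X 0, MvPolynomial.X 1, MvPolynomial.X 2 ^ (m / 2)} : Set (MvPolynomial (Fin 3) k))).map
        (Ideal.Quotient.mk (Ideal.span {(MvPolynomial.X 0 * MvPolynomial.X 1 - MvPolynomial.X 2 ^ m :
          MvPolynomial (Fin 3) k)})) :=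
  le_antisymm (cohomologyAnnihilatorOfDegree_arena_X_pow_le' k m 3)
    (ArenaFloorCharFree.span_le_cohomologyAnnihilatorOfDegree_three_arena' k m)

/-- `ca(k[x,y,z]/(xy − zᵐ)) = ca³(k[x,y,z]/(xy − zᵐ))` over every field. [cite: IyengarTakahashi2014, Definition 2.1] -/
theorem cohomologyAnnihilator_arena_X_pow_eq_cohomologyAnnihilatorOfDegree_three' :
    cohomologyAnnihilator (MvPolynomial (Fin 3) k ⧸
        Ideal.span {(MvPolynomial.X 0 * MvPolynomial.X 1 - MvPolynomial.X 2 ^ m : MvPolynomial (Fin 3) k)}) =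
      cohomologyAnnihilatorOfDegree (MvPolynomial (Fin 3) k ⧸
        Ideal.span {(MvPolynomial.X 0 * MvPolynomial.X 1 - MvPolynomial.X 2 ^ m : MvPolynomial (Fin 3) k)}) 3 := by
  rw [cohomologyAnnihilator_arena_X_pow_eq', cohomologyAnnihilatorOfDegree_three_arena_X_pow_eq']

end Summit.ResolutionOfSingularities.ResolutionOfSingularities.Theorems.HomologicalConductor.ArenaCeilingCharFree

end
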